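import Mathlib
import HarnessLib
import Summits.NavierStokesRegularity.FluidComputer.TriggeredTransferBounded

/-!
# Fluid computer, door N1-FC — the triggered-transfer scheme, DOOR v2: an `H¹` alphabet above ignition
# (module A: the type, its predicates, and the embedding of the v1 door)

Cell `ns-blowup`; drafted by the door's owner `ns-blowup-fc-route` (g3; RULING «door v2» of 2026-08-26, ns-blowup
STATUS l.3869, DRAFT `plan/route-draft-FC/door-v2/TriggeredTransferH1.DRAFT.lean` 839c72b3c3526d87) and filed by the
prover seat `ns-blowup-fc-prover-2` (g5) as TWO modules for the tree's 400-line rule, every declaration NAME and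
namespace of the draft kept: this module = the draft's §1–§2; `TriggeredTransferH1Junction.lean` = its §3–§4 (`H¹`
through the zoom, the unforced junction from `H¹` data) plus the hand-over regularity of a v2 link. LABEL: E–C typing
hygiene. WHAT THIS IS NOT: not Navier–Stokes evidence and not a construction — one TYPE, its predicates (formulas
VERBATIM those of `TriggerScheme`), and the embedding of the v1 door into it; no instance of any scheme is claimed, no
transfer and no blow-up is asserted.

**Why a v2.** The v1 type `TriggerScheme` (`TriggeredTransfer.lean`) asks of EVERY member of EVERY level family
`F U`, `U ≥ U⋆`, the three Clay clauses (A)(4): smooth, divergence free, RAPIDLY DECAYING (`TriggerScheme.clay`). The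
closers consume rapid decay in exactly two places: the datum of the glued witness (`Run.toWitness.datum_decay` — the
IGNITION member only) and the unforced junctions (`Run.vel_eq_vel_succ`, `eq_on_unforced_window`), where it enters
ONLY through `ClayUniqueness.memLp_two_of_rapidDecay` to produce `u(t₁) ∈ L²`, `∇u(t₁) ∈ L²` — the data class of the
tree theorem `tao_unconditional_uniqueness_velocity_holds` (Tao 2013, Cor. 11.4). But the exact hand-over of
`TriggerScheme.Step`, `u T = x ↦ λ • w' (λ • (x - x₀))` with `w' ∈ F U'`, then demands Fefferman-(4) decay of a
Navier–Stokes state at a time `T > 0` at every level — generically false (instantaneous spreading: `|x|⁻⁴` far-field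
tails unless special symmetry, Brandolese–Meyer), i.e. an infinite family of moment conditions on the design that
no closer uses. Door v2 asks above ignition exactly what the junction consumes — smooth, divergence free, `H¹`
(`TriggerSchemeH1.regular`) — and rapid decay of ONE ignition member (`TriggerSchemeH1.seed`); every other field and
the formulas of `IsTrigger` / `Step` / `Transfers` / `Link` / `StepB` / `TransfersB` are those of v1 verbatim.

**Contents.** §1 the type and its predicates; §2 the embedding `TriggerScheme.toH1` with `toH1_step_iff`,
`toH1_transfers_iff`, `toH1_stepB_iff`, `toH1_transfersB_iff` and the corollaries
`exists_transfersH1_of_exists_transfers`, `exists_transfersBH1_of_exists_transfersB` — the v2 existential crux is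
formally WEAKER than v1's (nothing filed over v1 is wasted). DEFERRED (ruling (4), not in the tree yet): the port of
the cascade chain `Run → … → toWitness → navierStokesBreakdownR3_of_exists_transfersB` to `TriggerSchemeH1` (two proof
steps change: `clay_vel_start` ↦ `regular_zoom` at the junction, `datum_decay` from the `seed` member the run starts
at); until then the door of record closing (C) in the tree is v1-B
(`TriggerScheme.navierStokesBreakdownR3_of_exists_transfersB`).

References: T. Tao, J. Amer. Math. Soc. 29 (2016) 601–674, §1.3 [cite: Tao2016AveragedNS, §1.3]; C. L. Fefferman,
Clay problem description, (A)(4), (C) [cite: FeffermanClay2006, (C)]; T. Tao, Anal. PDE 6 (2013), Cor. 11.4,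
Cor. 11.1 [cite: Tao2011, Cor. 11.4]; L. Brandolese, Y. Meyer, Proc. AMS 130 (2002) 1483–1487 and L. Brandolese,
Math. Ann. 329 (2004) 685–706, §1 (instantaneous spreading) [cite: Brandolese2004, §1]; J. Leray, Acta Math. 63 (1934) §20 [cite: Leray1934, §20].

0 sorry; axioms ⊆ {propext, Classical.choice, Quot.sound}.
-/

noncomputable section

namespace Summit.NavierStokesRegularity.FluidComputer.TriggeredTransfer

open Set MeasureTheory Function Module
open scoped ENNReal ContDiff NNReal
open Literature.Analysis.FluidPDE
open Literature.Analysis.FluidPDE.FluidComputer (E3 Vel)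
open Summit.NavierStokesRegularity.NavierStokesRegularity.Theorems

/-! ## §1 The type and its predicates (door v2) -/

/-- **A one-shot triggered-transfer scheme at unit scale, door v2 (`H¹` alphabet above ignition).**
Same data and sign axioms as `TriggerScheme`; the level states are smooth divergence-free `H¹` fields
(`regular` — the data class of Tao 2013 Cor. 11.4, which is all the junction consumes), and ONE member
of some level `U ≥ U⋆` is a rapidly decaying Clay datum (`seed` — the ignition state the run starts
at, Fefferman (A)(4)). A TYPE; no instance is claimed. [cite: Tao2016AveragedNS, §1.3] -/
structure TriggerSchemeH1 where
  /-- scale ratio `λ` between consecutive levels -/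
  lam : ℝ
  /-- efficiency floor `η`: child energy / parent energy -/
  eta : ℝ
  /-- threshold amplitude (level Reynolds number at unit viscosity) -/
  UStar : ℝ
  /-- the designed family of unit-scale level states, indexed by the amplitude `U` -/
  F : ℝ → Set Vel
  /-- radius of the closed nest ball (speed floor inside, triggers supported inside) -/
  R : ℝ
  /-- speed-floor constant -/
  c : ℝ
  /-- bound on the displacement of the child's centre (unit scale) -/
  D : ℝ
  /-- trigger shape constants: `‖Dⁱ g‖ ≤ ε * A i` -/
  A : ℕ → ℝ
  /-- e-fold budget per unit Reynolds number: `ε` is admissible iff `ν |log ε| ≤ a U` -/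
  a : ℝ
  /-- transfer-time constant (turnover units) -/
  Cτ : ℝ
  /-- poly-logarithmic exponent of the transfer-time law -/
  q : ℕ
  one_lt_lam : 1 < lam
  /-- the Kelvin-critical (FC-AUDIT) floor `η > 1/λ` -/
  kelvin : 1 < eta * lam
  eta_le_one : eta ≤ 1
  UStar_pos : 0 < UStar
  R_pos : 0 < R
  c_pos : 0 < c
  D_nonneg : 0 ≤ D
  A_nonneg : ∀ i, 0 ≤ A i
  a_pos : 0 < a
  Cτ_pos : 0 < Cτ
  /-- every level state is a smooth divergence-free `H¹` field (Tao 2013 Cor. 11.4's data class) -/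
  regular : ∀ U, UStar ≤ U → ∀ w ∈ F U,
    ContDiff ℝ ∞ w ∧ NSWave0.IsDivFree w ∧ MemLp w 2 volume ∧ MemLp (fderiv ℝ w) 2 volume
  /-- speed floor: a level state of amplitude `U` has speed `≥ c U` somewhere in the nest ball -/
  floor : ∀ U, UStar ≤ U → ∀ w ∈ F U, ∃ x : E3, ‖x‖ ≤ R ∧ c * U ≤ ‖w x‖
  /-- the ignition level is inhabited by a rapidly decaying Clay datum (A)(4) -/
  seed : ∃ U, UStar ≤ U ∧ ∃ w ∈ F U, HasRapidSpatialDecay w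

namespace TriggerSchemeH1

variable (𝒮 : TriggerSchemeH1)

/-- The amplitude growth factor per level `(η λ)^{1/2}`. [folklore] -/
def growth : ℝ := Real.sqrt (𝒮.eta * 𝒮.lam)

/-- The Kelvin floor `1 < ηλ` is exactly `1 < (ηλ)^{1/2}`. [folklore] -/
theorem one_lt_growth (𝒮 : TriggerSchemeH1) : 1 < 𝒮.growth := by
  unfold growth
  calc (1 : ℝ) = Real.sqrt 1 := Real.sqrt_one.symm
    _ < Real.sqrt (𝒮.eta * 𝒮.lam) := Real.sqrt_lt_sqrt zero_le_one 𝒮.kelvin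

/-- The scale ratio is positive. [folklore] -/
theorem lam_pos (𝒮 : TriggerSchemeH1) : 0 < 𝒮.lam := zero_lt_one.trans 𝒮.one_lt_lam

/-- An admissible trigger of amplitude `ε` for the window `[0, T]` (verbatim `TriggerScheme.IsTrigger`).
[cite: FeffermanClay2006, (C) (5)] -/
structure IsTrigger (ε δ T : ℝ) (g : ℝ → Vel) : Prop where
  smooth : ContDiff ℝ ∞ (uncurry g)
  off_early : ∀ t, t ≤ δ → g t = 0
  off_late : ∀ t, T ≤ t → g t = 0
  off_far : ∀ (t : ℝ) (x : E3), 𝒮.R ≤ ‖x‖ → g t x = 0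
  small : ∀ (i : ℕ) (z : ℝ × E3), ‖iteratedFDeriv ℝ i (uncurry g) z‖ ≤ ε * 𝒮.A i

/-- One triggered transfer at viscosity `ν` from the level state `w` of amplitude `U` with trigger
amplitude `ε` (verbatim `TriggerScheme.Step`: exact classical forced solution on `[0, T + δ]`, finite
energy, exact hand-over `u T = x ↦ λ • w' (λ • (x - x₀))` to a member one amplitude level up).
[cite: Tao2016AveragedNS, §1.3] -/
def Step (ν U ε : ℝ) (w : Vel) : Prop :=
  ∃ (T δ : ℝ) (g : ℝ → Vel) (u : ℝ → Vel) (p : ℝ → E3 → ℝ),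
    0 < δ ∧ 2 * δ < T ∧ T ≤ 𝒮.Cτ * (1 + |Real.log ε|) ^ 𝒮.q / U ∧
    𝒮.IsTrigger ε δ T g ∧
    IsClassicalNSSolutionOn (Icc 0 (T + δ)) ν g u p ∧ u 0 = w ∧
    (∃ C : ℝ≥0∞, C < ⊤ ∧ ∀ t ∈ Icc 0 (T + δ), ∫⁻ x, ‖u t x‖ₑ ^ 2 ≤ C) ∧
    ∃ (U' : ℝ) (w' : Vel) (x₀ : E3), 𝒮.growth * U ≤ U' ∧ w' ∈ 𝒮.F U' ∧ ‖x₀‖ ≤ 𝒮.D ∧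
      u T = fun x => 𝒮.lam • w' (𝒮.lam • (x - x₀))

/-- The scheme transfers at viscosity `ν` (verbatim `TriggerScheme.Transfers`): one triggered transfer
from every member at every amplitude `U ≥ U⋆` for every admissible `ε` (`0 < ε ≤ 1`,
`ν |log ε| ≤ a U`). The physics of door N1-FC, v2 typing; open, never asserted. [cite: Tao2016AveragedNS, §1.3] -/
def Transfers (ν : ℝ) : Prop :=
  ∀ U, 𝒮.UStar ≤ U → ∀ w ∈ 𝒮.F U, ∀ ε : ℝ, 0 < ε → ε ≤ 1 → ν * |Real.log ε| ≤ 𝒮.a * U →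
    𝒮.Step ν U ε w

/-- The witnesses of a step as a structure (verbatim `TriggerScheme.Link`). [cite: Tao2016AveragedNS, §1.3] -/
structure Link (ν U ε : ℝ) (w : Vel) where
  /-- hand-over time -/
  T : ℝ
  /-- margin -/
  δ : ℝ
  /-- the trigger -/
  g : ℝ → Vel
  /-- velocity of the piece -/
  u : ℝ → Vel
  /-- pressure of the piece -/
  p : ℝ → E3 → ℝ
  /-- amplitude of the hand-over state -/
  U' : ℝ
  /-- the member handed over to (unit scale) -/
  w' : Vel
  /-- centre of the child -/
  x₀ : E3
  δ_pos : 0 < δ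
  two_δ_lt : 2 * δ < T
  T_le : T ≤ 𝒮.Cτ * (1 + |Real.log ε|) ^ 𝒮.q / U
  trigger : 𝒮.IsTrigger ε δ T g
  classical : IsClassicalNSSolutionOn (Icc 0 (T + δ)) ν g u p
  initial : u 0 = w
  energy : ∃ C : ℝ≥0∞, C < ⊤ ∧ ∀ t ∈ Icc 0 (T + δ), ∫⁻ x, ‖u t x‖ₑ ^ 2 ≤ C
  growth_le : 𝒮.growth * U ≤ U'
  mem : w' ∈ 𝒮.F U'
  norm_x₀_le : ‖x₀‖ ≤ 𝒮.D
  handover : u T = fun x => 𝒮.lam • w' (𝒮.lam • (x - x₀))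

/-- `Step` holds iff `Link` is inhabited. [folklore] -/
theorem step_iff_nonempty_link (𝒮 : TriggerSchemeH1) {ν U ε : ℝ} {w : Vel} :
    𝒮.Step ν U ε w ↔ Nonempty (𝒮.Link ν U ε w) := by
  constructor
  · rintro ⟨T, δ, g, u, p, hδ, h2δ, hT, htrig, hcl, hu0, hE, U', w', x₀, hgrow, hw', hx₀, hhand⟩
    exact ⟨⟨T, δ, g, u, p, U', w', x₀, hδ, h2δ, hT, htrig, hcl, hu0, hE, hgrow, hw', hx₀, hhand⟩⟩
  · rintro ⟨L⟩
    exact ⟨L.T, L.δ, L.g, L.u, L.p, L.δ_pos, L.two_δ_lt, L.T_le, L.trigger, L.classical, L.initial,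
      L.energy, L.U', L.w', L.x₀, L.growth_le, L.mem, L.norm_x₀_le, L.handover⟩

/-- One BOUNDED triggered transfer (verbatim `TriggerScheme.StepB`): a link whose velocity has a
ceiling on the closed slab. [cite: Tao2016AveragedNS, §1.3] -/
def StepB (ν U ε : ℝ) (w : Vel) : Prop :=
  ∃ L : 𝒮.Link ν U ε w, ∃ M : ℝ, ∀ t ∈ Icc 0 (L.T + L.δ), ∀ x, ‖L.u t x‖ ≤ M

/-- The scheme transfers WITH CEILINGS at viscosity `ν` (verbatim `TriggerScheme.TransfersB`). Open;
never asserted. [cite: Tao2016AveragedNS, §1.3] -/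
def TransfersB (ν : ℝ) : Prop :=
  ∀ U, 𝒮.UStar ≤ U → ∀ w ∈ 𝒮.F U, ∀ ε : ℝ, 0 < ε → ε ≤ 1 → ν * |Real.log ε| ≤ 𝒮.a * U →
    𝒮.StepB ν U ε w

variable {𝒮}

/-- Forgetting the ceiling: a bounded step is a step. [folklore] -/
theorem StepB.step {𝒮 : TriggerSchemeH1} {ν U ε : ℝ} {w : Vel} (h : 𝒮.StepB ν U ε w) :
    𝒮.Step ν U ε w := by
  obtain ⟨L, -⟩ := h
  exact 𝒮.step_iff_nonempty_link.2 ⟨L⟩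

/-- Forgetting the ceilings: `TransfersB → Transfers`. [folklore] -/
theorem TransfersB.transfers {𝒮 : TriggerSchemeH1} {ν : ℝ} (h : 𝒮.TransfersB ν) :
    𝒮.Transfers ν :=
  fun U hU w hw ε hε hε1 hlog => (h U hU w hw ε hε hε1 hlog).step

end TriggerSchemeH1

/-! ## §2 The v1 door embeds in the v2 door -/

namespace TriggerScheme

variable (𝒮 : TriggerScheme)

/-- **The embedding.** A v1 scheme IS a v2 scheme with the same data: a rapidly decaying `C^∞` field is
`H¹` (`ClayUniqueness.memLp_two_of_rapidDecay`), and the v1 ignition member is rapidly decaying by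
`clay`. [folklore] -/
def toH1 : TriggerSchemeH1 where
  lam := 𝒮.lam
  eta := 𝒮.eta
  UStar := 𝒮.UStar
  F := 𝒮.F
  R := 𝒮.R
  c := 𝒮.c
  D := 𝒮.D
  A := 𝒮.A
  a := 𝒮.a
  Cτ := 𝒮.Cτ
  q := 𝒮.q
  one_lt_lam := 𝒮.one_lt_lam
  kelvin := 𝒮.kelvin
  eta_le_one := 𝒮.eta_le_one
  UStar_pos := 𝒮.UStar_pos
  R_pos := 𝒮.R_pos
  c_pos := 𝒮.c_pos
  D_nonneg := 𝒮.D_nonneg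
  A_nonneg := 𝒮.A_nonneg
  a_pos := 𝒮.a_pos
  Cτ_pos := 𝒮.Cτ_pos
  regular U hU w hw := by
    obtain ⟨h1, h2, h3⟩ := 𝒮.clay U hU w hw
    exact ⟨h1, h2, ClayUniqueness.memLp_two_of_rapidDecay h3 (h1.of_le (by norm_cast))⟩
  floor := 𝒮.floor
  seed := by
    obtain ⟨U, hU, w, hw⟩ := 𝒮.seed
    exact ⟨U, hU, w, hw, (𝒮.clay U hU w hw).2.2⟩

/-- The embedding keeps `λ`. [folklore] -/
@[simp] theorem toH1_lam : 𝒮.toH1.lam = 𝒮.lam := rfl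
/-- The embedding keeps `η`. [folklore] -/
@[simp] theorem toH1_eta : 𝒮.toH1.eta = 𝒮.eta := rfl
/-- The embedding keeps the threshold `U⋆`. [folklore] -/
@[simp] theorem toH1_UStar : 𝒮.toH1.UStar = 𝒮.UStar := rfl
/-- The embedding keeps the alphabet `F`. [folklore] -/
@[simp] theorem toH1_F : 𝒮.toH1.F = 𝒮.F := rfl
/-- The embedding keeps the nest radius `R`. [folklore] -/
@[simp] theorem toH1_R : 𝒮.toH1.R = 𝒮.R := rfl
/-- The embedding keeps the speed-floor constant `c`. [folklore] -/
@[simp] theorem toH1_c : 𝒮.toH1.c = 𝒮.c := rfl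
/-- The embedding keeps the displacement bound `D`. [folklore] -/
@[simp] theorem toH1_D : 𝒮.toH1.D = 𝒮.D := rfl
/-- The embedding keeps the trigger shape constants `A`. [folklore] -/
@[simp] theorem toH1_A : 𝒮.toH1.A = 𝒮.A := rfl
/-- The embedding keeps the e-fold budget `a`. [folklore] -/
@[simp] theorem toH1_a : 𝒮.toH1.a = 𝒮.a := rfl
/-- The embedding keeps the transfer-time constant `C_τ`. [folklore] -/
@[simp] theorem toH1_Cτ : 𝒮.toH1.Cτ = 𝒮.Cτ := rfl
/-- The embedding keeps the exponent `q`. [folklore] -/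
@[simp] theorem toH1_q : 𝒮.toH1.q = 𝒮.q := rfl

/-- The growth factor is unchanged. [folklore] -/
@[simp] theorem toH1_growth : 𝒮.toH1.growth = 𝒮.growth := rfl

/-- Triggers are the same predicate. [folklore] -/
theorem toH1_isTrigger_iff {ε δ T : ℝ} {g : ℝ → Vel} :
    𝒮.toH1.IsTrigger ε δ T g ↔ 𝒮.IsTrigger ε δ T g :=
  ⟨fun h => ⟨h.smooth, h.off_early, h.off_late, h.off_far, h.small⟩,
    fun h => ⟨h.smooth, h.off_early, h.off_late, h.off_far, h.small⟩⟩

/-- Steps are the same predicate. [folklore] -/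
theorem toH1_step_iff {ν U ε : ℝ} {w : Vel} : 𝒮.toH1.Step ν U ε w ↔ 𝒮.Step ν U ε w := by
  simp only [TriggerSchemeH1.Step, TriggerScheme.Step, toH1_isTrigger_iff, toH1_growth, toH1_F,
    toH1_D, toH1_lam, toH1_Cτ, toH1_q]

/-- `Transfers` is the same predicate. [folklore] -/
theorem toH1_transfers_iff {ν : ℝ} : 𝒮.toH1.Transfers ν ↔ 𝒮.Transfers ν := by
  simp only [TriggerSchemeH1.Transfers, TriggerScheme.Transfers, toH1_step_iff, toH1_UStar, toH1_F,
    toH1_a]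

/-- A v1 link is a v2 link of the embedded scheme. [folklore] -/
def Link.toH1 {ν U ε : ℝ} {w : Vel} (L : 𝒮.Link ν U ε w) : 𝒮.toH1.Link ν U ε w where
  T := L.T
  δ := L.δ
  g := L.g
  u := L.u
  p := L.p
  U' := L.U'
  w' := L.w'
  x₀ := L.x₀
  δ_pos := L.δ_pos
  two_δ_lt := L.two_δ_lt
  T_le := L.T_le
  trigger := 𝒮.toH1_isTrigger_iff.2 L.trigger
  classical := L.classical
  initial := L.initial
  energy := L.energy
  growth_le := L.growth_le
  mem := L.mem
  norm_x₀_le := L.norm_x₀_le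
  handover := L.handover

/-- A v2 link of the embedded scheme is a v1 link. [folklore] -/
def Link.ofH1 {ν U ε : ℝ} {w : Vel} (L : 𝒮.toH1.Link ν U ε w) : 𝒮.Link ν U ε w where
  T := L.T
  δ := L.δ
  g := L.g
  u := L.u
  p := L.p
  U' := L.U'
  w' := L.w'
  x₀ := L.x₀
  δ_pos := L.δ_pos
  two_δ_lt := L.two_δ_lt
  T_le := L.T_le
  trigger := 𝒮.toH1_isTrigger_iff.1 L.trigger
  classical := L.classical
  initial := L.initial
  energy := L.energy
  growth_le := L.growth_le
  mem := L.mem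
  norm_x₀_le := L.norm_x₀_le
  handover := L.handover

/-- Bounded steps are the same predicate. [folklore] -/
theorem toH1_stepB_iff {ν U ε : ℝ} {w : Vel} : 𝒮.toH1.StepB ν U ε w ↔ 𝒮.StepB ν U ε w := by
  constructor
  · rintro ⟨L, M, hM⟩
    exact ⟨Link.ofH1 𝒮 L, M, hM⟩
  · rintro ⟨L, M, hM⟩
    exact ⟨Link.toH1 𝒮 L, M, hM⟩

/-- `TransfersB` is the same predicate. [folklore] -/
theorem toH1_transfersB_iff {ν : ℝ} : 𝒮.toH1.TransfersB ν ↔ 𝒮.TransfersB ν := by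
  simp only [TriggerSchemeH1.TransfersB, TriggerScheme.TransfersB, toH1_stepB_iff, toH1_UStar,
    toH1_F, toH1_a]

end TriggerScheme

/-- **The v2 existential crux is formally weaker than v1's** (exact door). [folklore] -/
theorem exists_transfersH1_of_exists_transfers {ν : ℝ} (h : ∃ 𝒮 : TriggerScheme, 𝒮.Transfers ν) :
    ∃ 𝒮 : TriggerSchemeH1, 𝒮.Transfers ν := by
  obtain ⟨𝒮, h𝒮⟩ := h
  exact ⟨𝒮.toH1, 𝒮.toH1_transfers_iff.2 h𝒮⟩

/-- **The v2 existential crux is formally weaker than v1's** (bounded door — the one that closes (C)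
binder-free in the tree, `TriggerScheme.navierStokesBreakdownR3_of_exists_transfersB`). [folklore] -/
theorem exists_transfersBH1_of_exists_transfersB {ν : ℝ} (h : ∃ 𝒮 : TriggerScheme, 𝒮.TransfersB ν) :
    ∃ 𝒮 : TriggerSchemeH1, 𝒮.TransfersB ν := by
  obtain ⟨𝒮, h𝒮⟩ := h
  exact ⟨𝒮.toH1, 𝒮.toH1_transfersB_iff.2 h𝒮⟩

end Summit.NavierStokesRegularity.FluidComputer.TriggeredTransfer

end
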